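import Summits.BirchSwinnertonDyer.BirchSwinnertonDyer.Theorems.ManinLocalTwoThreeCurveExclusionFortyFour
import Literature.NumberTheory.EllipticCurves.NewformsOldNewProofs
import Literature.NumberTheory.EllipticCurves.ModularCurve
import Literature.NumberTheory.EllipticCurves.TwistedLValueSeries
import Literature.NumberTheory.EllipticCurves.CuspFormLFunctionProofs
import Mathlib.NumberTheory.ModularForms.CuspFormSubmodule
import HarnessLib

/-!
# Level `44`, part 2: NEWFORM PINNING MODULO THE COEFFICIENT TABLE OF `M₂(Γ₀(44))`

Cell `bsd-f2-manin`, route `ManinLocalTwoThree`, crux C2 `ManinOddAtFour` (stmt-BirchSwinnertonDyer-22967), LEAD p1 gen 24;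
`--supports stmt-BirchSwinnertonDyer-22967` (helper).  Companion of `…CurveExclusionFortyFour` (the arithmetic core).

THE DEVICE (an g51 MEMO-an §96, M₂-variant).  `dim M₂(Γ₀(44)) = g + ν_∞ − 1 = 9`
(`Literature.NumberTheory.EllipticCurves.ModularForms.finrank_modularForm_two_eq`) and `M₂(Γ₀(44))` is spanned by nine
holomorphic `η`-quotients whose `q`-coefficients at the pivot columns `n ∈ {0,1,2,3,4,5,6,8,11}` separate the space
(certificate `HOME/p1/g24/pinsolve44-M2.out`).  Consequently EVERY `F ∈ M₂(Γ₀(44))` satisfies the eight column relations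
`a₇ = 2a₃`, `a₉ = −a₁ + 2a₃ + a₅`, `a₁₀ = 2a₂ + a₆`, `a₁₂ = 2a₂ + a₄ + a₈`, `a₁₅ = 3a₃ + 2a₅`, `a₁₆ = 4a₂ + 4a₄ − 2a₆ + a₈`,
`a₁₉ = 4a₁ + 4a₃`, `a₃₃ = −2a₁ + 2a₃ − a₅ + 4a₁₁`, and two forms with the same pivot coefficients coincide.  This file takes
exactly these statements as HYPOTHESES (`ColumnRelations44`, `PivotsSeparate44` are spelled out inline, no definition) —
they are the content of the certified coefficient table through `q³³` and are discharged in a sequel by the tree's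
`QRemainder`/`QCoefficientBridge` calculus — and proves:

* `coeffs_cases_of_columnRelations` : for every `X₀(44)`-datum `D` of an elliptic `W/ℚ`, the curve's
  `(a₂,a₃,a₄,a₅,a₆,a₈,a₁₁)` is the vector of `44a1`, of the `2`-depleted `11a1`, or of `11a1` (part 1 applied to
  `F = D.f ∈ S₂ ⊆ M₂`);
* `not_mem_oldSubspace0_of_isNewform0` : a `Γ₀(N)`-newform is never an oldform (`old ⊓ new = ⊥`, PROVED in the tree:
  `disjoint_oldSubspace0_newSubspace0_holds`; `a₁ = 1` makes it non-zero) — generic;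
* `coeffs_eq_fortyFourA` : given, in addition, two OLD cusp forms with the pivot coefficients of `11a1` and of its
  `2`-depletion (`ι₁φ₁₁` and `ι₁φ₁₁ + 2ι₂φ₁₁ + 2ι₄φ₁₁`, `φ₁₁ = η(τ)²η(11τ)²` — exhibited in the sequel), the pivot
  vector of `D.f` IS that of `44a1`: `a₂ = a₄ = a₆ = a₈ = 0`, `a₃ = 1`, `a₅ = −3`, `a₁₁ = −1`;
* `coe_f_eq_of_pivots` : hence `⇑D.f = ⇑Φ` for ANY `Φ ∈ M₂(Γ₀(44))` with those nine pivot coefficients — the explicit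
  `η`-combination `Φ₄₄ = ½B₁ + 15/8·B₂ − ½B₄ − 3/16·B₅ − 15/8·B₆ + 3/8·B₇ − 3/16·B₉` of the sequel — WITHOUT ever proving
  that `Φ₄₄` is new, an eigenform, or even cuspidal.

HONEST FRAMING: conditional on the (decidable, finite) coefficient-table statements it names; no definition, no named
fact, no sorry.  With the sequel (table) and the Néron squeeze for `44a1` (an §95.7) it yields `|c| = 1 ∧ 2 ∤ c` on
`X₀(44)` fact-free.  Nothing here proves C2, Manin's conjecture or BSD.
[cite: DiamondShurman2005, Thm. 3.5.1, §5.6, §8.8 (8.44)] [cite: AtkinLehner1970, Thm. 5] [cite: CremonaAlgorithms1997, Table 3 (N = 11, 44)]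
-/

set_option autoImplicit false
-- lint-debt: the directory name repeats the summit name (sibling precedent `ManinLocalTwoThreeNewformFortyEight.lean`)
set_option linter.dupNamespace false

noncomputable section

open scoped MatrixGroups ModularForm
open CongruenceSubgroup UpperHalfPlane
open Literature.NumberTheory.EllipticCurves Literature.NumberTheory.EllipticCurves.ModularForms

namespace Summit.BirchSwinnertonDyer.BirchSwinnertonDyer.Theorems.ManinLocalTwoThree.LevelFortyFour

/-! ## §1 Generic: a newform is never an oldform -/

/-- **A `Γ₀(N)`-newform is not an oldform**: `old ⊓ new = ⊥` (tree theorem `disjoint_oldSubspace0_newSubspace0_holds`)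
and `a₁ = 1 ≠ 0`. [cite: AtkinLehner1970, Thm. 5] -/
theorem not_mem_oldSubspace0_of_isNewform0 {N : ℕ} [NeZero N] {k : ℤ} {f : CuspForm (Gamma0 N) k}
    (hf : IsNewform0 f) : f ∉ oldSubspace0 N k := by
  intro hold
  have h0 : f = 0 := by
    have hd := disjoint_oldSubspace0_newSubspace0_holds N k
    rw [disjoint_oldSubspace0_newSubspace0, Submodule.disjoint_def] at hd
    exact hd f hold hf.1
  have h1 : (qExpansion 1 ⇑f).coeff 1 = 1 := hf.2.2
  rw [h0] at h1
  have hz : (qExpansion (1 : ℝ) ⇑(0 : CuspForm (Gamma0 N) k)).coeff 1 = 0 := by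
    have : (⇑(0 : CuspForm (Gamma0 N) k) : ℍ → ℂ) = 0 := rfl
    rw [this, qExpansion_zero]; simp
  rw [hz] at h1
  exact zero_ne_one h1

/-! ## §2 Level 44: the pinning modulo the column relations of `M₂(Γ₀(44))` -/

variable {W : WeierstrassCurve ℚ} [W.IsElliptic]

omit [W.IsElliptic] in
/-- The coefficients of the modular form underlying `D.f` are the curve's `aₙ`. [folklore] -/
theorem coeff_toModularForm_f (D : ModularParametrizationData W 44) (n : ℕ) :
    (qExpansion 1 ⇑(CuspForm.toModularFormₗ D.f)).coeff n = (W.LFunction n : ℂ) := by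
  have hcoe : (⇑(CuspForm.toModularFormₗ D.f) : ℍ → ℂ) = ⇑D.f := funext (CuspForm.toModularFormₗ_apply D.f)
  rw [hcoe]
  exact D.isNewformOf.2 n

/-- **The three cases.** If every `F ∈ M₂(Γ₀(44))` satisfies the eight column relations of the holomorphic `η`-quotient
basis (pivots `0,1,2,3,4,5,6,8,11`), then for every `X₀(44)`-datum `D` of an elliptic `W/ℚ` the curve's pivot vector is
that of `44a1`, of the `2`-depleted `11a1`, or of `11a1`. [cite: DiamondShurman2005, §8.8 (8.44)] -/
theorem coeffs_cases_of_columnRelations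
    (hrel : ∀ F : ModularForm (Gamma0 44) 2,
      (qExpansion 1 ⇑F).coeff 7 = 2 * (qExpansion 1 ⇑F).coeff 3 ∧
      (qExpansion 1 ⇑F).coeff 9 = -(qExpansion 1 ⇑F).coeff 1 + 2 * (qExpansion 1 ⇑F).coeff 3 + (qExpansion 1 ⇑F).coeff 5 ∧
      (qExpansion 1 ⇑F).coeff 10 = 2 * (qExpansion 1 ⇑F).coeff 2 + (qExpansion 1 ⇑F).coeff 6 ∧
      (qExpansion 1 ⇑F).coeff 12 = 2 * (qExpansion 1 ⇑F).coeff 2 + (qExpansion 1 ⇑F).coeff 4 + (qExpansion 1 ⇑F).coeff 8 ∧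
      (qExpansion 1 ⇑F).coeff 15 = 3 * (qExpansion 1 ⇑F).coeff 3 + 2 * (qExpansion 1 ⇑F).coeff 5 ∧
      (qExpansion 1 ⇑F).coeff 16 = 4 * (qExpansion 1 ⇑F).coeff 2 + 4 * (qExpansion 1 ⇑F).coeff 4 -
        2 * (qExpansion 1 ⇑F).coeff 6 + (qExpansion 1 ⇑F).coeff 8 ∧
      (qExpansion 1 ⇑F).coeff 19 = 4 * (qExpansion 1 ⇑F).coeff 1 + 4 * (qExpansion 1 ⇑F).coeff 3 ∧
      (qExpansion 1 ⇑F).coeff 33 = -2 * (qExpansion 1 ⇑F).coeff 1 + 2 * (qExpansion 1 ⇑F).coeff 3 -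
        (qExpansion 1 ⇑F).coeff 5 + 4 * (qExpansion 1 ⇑F).coeff 11)
    (D : ModularParametrizationData W 44) :
    (W.LFunction 2 = 0 ∧ W.LFunction 3 = 1 ∧ W.LFunction 4 = 0 ∧ W.LFunction 5 = -3 ∧ W.LFunction 6 = 0 ∧
        W.LFunction 8 = 0 ∧ W.LFunction 11 = -1) ∨
      (W.LFunction 2 = 0 ∧ W.LFunction 3 = -1 ∧ W.LFunction 4 = 0 ∧ W.LFunction 5 = 1 ∧ W.LFunction 6 = 0 ∧
        W.LFunction 8 = 0 ∧ W.LFunction 11 = 1) ∨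
      (W.LFunction 2 = -2 ∧ W.LFunction 3 = -1 ∧ W.LFunction 4 = 2 ∧ W.LFunction 5 = 1 ∧ W.LFunction 6 = 2 ∧
        W.LFunction 8 = 0 ∧ W.LFunction 11 = 1) := by
  obtain ⟨h7, h9, h10, h12, h15, h16, h19, h33⟩ := hrel (CuspForm.toModularFormₗ D.f)
  simp only [coeff_toModularForm_f D] at h7 h9 h10 h12 h15 h16 h19 h33
  exact coeffVector_fortyFour W (by exact_mod_cast h7) (by exact_mod_cast h9) (by exact_mod_cast h10)
    (by exact_mod_cast h12) (by exact_mod_cast h15) (by exact_mod_cast h16) (by exact_mod_cast h19)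
    (by exact_mod_cast h33)

/-- **The pinning of the pivot vector.**  If moreover two forms of `M₂(Γ₀(44))` with the same pivot coefficients have
the same underlying function, and the old subspace `S₂(Γ₀(44))^{old}` contains cusp forms with the pivot vectors of `11a1`
and of its `2`-depletion, then the pivot vector of `D.f` is that of `44a1`.
[cite: DiamondShurman2005, §5.6, §8.8 (8.44)] [cite: AtkinLehner1970, Thm. 5] -/
theorem coeffs_eq_fortyFourA
    (hrel : ∀ F : ModularForm (Gamma0 44) 2,
      (qExpansion 1 ⇑F).coeff 7 = 2 * (qExpansion 1 ⇑F).coeff 3 ∧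
      (qExpansion 1 ⇑F).coeff 9 = -(qExpansion 1 ⇑F).coeff 1 + 2 * (qExpansion 1 ⇑F).coeff 3 + (qExpansion 1 ⇑F).coeff 5 ∧
      (qExpansion 1 ⇑F).coeff 10 = 2 * (qExpansion 1 ⇑F).coeff 2 + (qExpansion 1 ⇑F).coeff 6 ∧
      (qExpansion 1 ⇑F).coeff 12 = 2 * (qExpansion 1 ⇑F).coeff 2 + (qExpansion 1 ⇑F).coeff 4 + (qExpansion 1 ⇑F).coeff 8 ∧
      (qExpansion 1 ⇑F).coeff 15 = 3 * (qExpansion 1 ⇑F).coeff 3 + 2 * (qExpansion 1 ⇑F).coeff 5 ∧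
      (qExpansion 1 ⇑F).coeff 16 = 4 * (qExpansion 1 ⇑F).coeff 2 + 4 * (qExpansion 1 ⇑F).coeff 4 -
        2 * (qExpansion 1 ⇑F).coeff 6 + (qExpansion 1 ⇑F).coeff 8 ∧
      (qExpansion 1 ⇑F).coeff 19 = 4 * (qExpansion 1 ⇑F).coeff 1 + 4 * (qExpansion 1 ⇑F).coeff 3 ∧
      (qExpansion 1 ⇑F).coeff 33 = -2 * (qExpansion 1 ⇑F).coeff 1 + 2 * (qExpansion 1 ⇑F).coeff 3 -
        (qExpansion 1 ⇑F).coeff 5 + 4 * (qExpansion 1 ⇑F).coeff 11)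
    (hinj : ∀ F G : ModularForm (Gamma0 44) 2,
      (qExpansion 1 ⇑F).coeff 0 = (qExpansion 1 ⇑G).coeff 0 → (qExpansion 1 ⇑F).coeff 1 = (qExpansion 1 ⇑G).coeff 1 →
      (qExpansion 1 ⇑F).coeff 2 = (qExpansion 1 ⇑G).coeff 2 → (qExpansion 1 ⇑F).coeff 3 = (qExpansion 1 ⇑G).coeff 3 →
      (qExpansion 1 ⇑F).coeff 4 = (qExpansion 1 ⇑G).coeff 4 → (qExpansion 1 ⇑F).coeff 5 = (qExpansion 1 ⇑G).coeff 5 →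
      (qExpansion 1 ⇑F).coeff 6 = (qExpansion 1 ⇑G).coeff 6 → (qExpansion 1 ⇑F).coeff 8 = (qExpansion 1 ⇑G).coeff 8 →
      (qExpansion 1 ⇑F).coeff 11 = (qExpansion 1 ⇑G).coeff 11 → (F : ℍ → ℂ) = G)
    (hold₁ : ∃ G : CuspForm (Gamma0 44) 2, G ∈ oldSubspace0 44 2 ∧ cuspCoeff G 1 = 1 ∧ cuspCoeff G 2 = -2 ∧
      cuspCoeff G 3 = -1 ∧ cuspCoeff G 4 = 2 ∧ cuspCoeff G 5 = 1 ∧ cuspCoeff G 6 = 2 ∧ cuspCoeff G 8 = 0 ∧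
      cuspCoeff G 11 = 1)
    (hold₂ : ∃ G : CuspForm (Gamma0 44) 2, G ∈ oldSubspace0 44 2 ∧ cuspCoeff G 1 = 1 ∧ cuspCoeff G 2 = 0 ∧
      cuspCoeff G 3 = -1 ∧ cuspCoeff G 4 = 0 ∧ cuspCoeff G 5 = 1 ∧ cuspCoeff G 6 = 0 ∧ cuspCoeff G 8 = 0 ∧
      cuspCoeff G 11 = 1)
    (D : ModularParametrizationData W 44) :
    W.LFunction 2 = 0 ∧ W.LFunction 3 = 1 ∧ W.LFunction 4 = 0 ∧ W.LFunction 5 = -3 ∧ W.LFunction 6 = 0 ∧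
      W.LFunction 8 = 0 ∧ W.LFunction 11 = -1 := by
  have hnot : D.f ∉ oldSubspace0 44 2 := not_mem_oldSubspace0_of_isNewform0 D.isNewformOf.1
  have hL1 : W.LFunction 1 = 1 := W.LFunction_apply_one
  -- the function of `D.f` is determined by its pivot coefficients: an old form with the same pivots equals `D.f`
  have key : ∀ G : CuspForm (Gamma0 44) 2, G ∈ oldSubspace0 44 2 →
      cuspCoeff G 1 = W.LFunction 1 → cuspCoeff G 2 = W.LFunction 2 → cuspCoeff G 3 = W.LFunction 3 →
      cuspCoeff G 4 = W.LFunction 4 → cuspCoeff G 5 = W.LFunction 5 → cuspCoeff G 6 = W.LFunction 6 →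
      cuspCoeff G 8 = W.LFunction 8 → cuspCoeff G 11 = W.LFunction 11 → False := by
    intro G hG g1 g2 g3 g4 g5 g6 g8 g11
    apply hnot
    have hcoeF : (⇑(CuspForm.toModularFormₗ D.f) : ℍ → ℂ) = ⇑D.f := funext (CuspForm.toModularFormₗ_apply D.f)
    have hcoeG : (⇑(CuspForm.toModularFormₗ G) : ℍ → ℂ) = ⇑G := funext (CuspForm.toModularFormₗ_apply G)
    have h0f : (qExpansion 1 ⇑(CuspForm.toModularFormₗ D.f)).coeff 0 = (qExpansion 1 ⇑(CuspForm.toModularFormₗ G)).coeff 0 := by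
      rw [hcoeF, hcoeG, CuspFormClass.qExpansion_coeff_zero D.f one_pos one_mem_strictPeriods_Gamma0,
        CuspFormClass.qExpansion_coeff_zero G one_pos one_mem_strictPeriods_Gamma0]
    have hp : ∀ n : ℕ, cuspCoeff G n = (W.LFunction n : ℂ) →
        (qExpansion 1 ⇑(CuspForm.toModularFormₗ D.f)).coeff n = (qExpansion 1 ⇑(CuspForm.toModularFormₗ G)).coeff n := by
      intro n hn
      rw [coeff_toModularForm_f D, hcoeG]
      exact hn.symm
    have hGf : (⇑(CuspForm.toModularFormₗ D.f) : ℍ → ℂ) = ⇑(CuspForm.toModularFormₗ G) :=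
      hinj _ _ h0f (hp 1 g1) (hp 2 g2) (hp 3 g3) (hp 4 g4) (hp 5 g5) (hp 6 g6) (hp 8 g8) (hp 11 g11)
    have hfun : (⇑D.f : ℍ → ℂ) = ⇑G := by rw [← hcoeF, ← hcoeG]; exact hGf
    have hDG : D.f = G := DFunLike.coe_injective hfun
    rw [hDG]; exact hG
  rcases coeffs_cases_of_columnRelations hrel D with h | ⟨h2, h3, h4, h5, h6, h8, h11⟩ | ⟨h2, h3, h4, h5, h6, h8, h11⟩
  · exact h
  · exfalso
    obtain ⟨G, hG, g1, g2, g3, g4, g5, g6, g8, g11⟩ := hold₂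
    exact key G hG (by rw [g1, hL1]; norm_num) (by rw [g2, h2]; norm_num) (by rw [g3, h3]; norm_num)
      (by rw [g4, h4]; norm_num) (by rw [g5, h5]; norm_num) (by rw [g6, h6]; norm_num) (by rw [g8, h8]; norm_num)
      (by rw [g11, h11]; norm_num)
  · exfalso
    obtain ⟨G, hG, g1, g2, g3, g4, g5, g6, g8, g11⟩ := hold₁
    exact key G hG (by rw [g1, hL1]; norm_num) (by rw [g2, h2]; norm_num) (by rw [g3, h3]; norm_num)
      (by rw [g4, h4]; norm_num) (by rw [g5, h5]; norm_num) (by rw [g6, h6]; norm_num) (by rw [g8, h8]; norm_num)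
      (by rw [g11, h11]; norm_num)

/-- **`⇑D.f = ⇑Φ` for any `Φ ∈ M₂(Γ₀(44))` with the pivot coefficients of `44a1`** (`a₀ = 0`, `a₁ = 1`, `a₂ = 0`, `a₃ = 1`,
`a₄ = 0`, `a₅ = −3`, `a₆ = 0`, `a₈ = 0`, `a₁₁ = −1`), under the same table hypotheses: the newform of every `X₀(44)`-datum is the
explicit form `Φ`, with no newness, eigenform or cuspidality statement about `Φ` ever proved. [cite: CremonaAlgorithms1997, Table 3 (N = 44)] -/
theorem coe_f_eq_of_pivots
    (hrel : ∀ F : ModularForm (Gamma0 44) 2,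
      (qExpansion 1 ⇑F).coeff 7 = 2 * (qExpansion 1 ⇑F).coeff 3 ∧
      (qExpansion 1 ⇑F).coeff 9 = -(qExpansion 1 ⇑F).coeff 1 + 2 * (qExpansion 1 ⇑F).coeff 3 + (qExpansion 1 ⇑F).coeff 5 ∧
      (qExpansion 1 ⇑F).coeff 10 = 2 * (qExpansion 1 ⇑F).coeff 2 + (qExpansion 1 ⇑F).coeff 6 ∧
      (qExpansion 1 ⇑F).coeff 12 = 2 * (qExpansion 1 ⇑F).coeff 2 + (qExpansion 1 ⇑F).coeff 4 + (qExpansion 1 ⇑F).coeff 8 ∧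
      (qExpansion 1 ⇑F).coeff 15 = 3 * (qExpansion 1 ⇑F).coeff 3 + 2 * (qExpansion 1 ⇑F).coeff 5 ∧
      (qExpansion 1 ⇑F).coeff 16 = 4 * (qExpansion 1 ⇑F).coeff 2 + 4 * (qExpansion 1 ⇑F).coeff 4 -
        2 * (qExpansion 1 ⇑F).coeff 6 + (qExpansion 1 ⇑F).coeff 8 ∧
      (qExpansion 1 ⇑F).coeff 19 = 4 * (qExpansion 1 ⇑F).coeff 1 + 4 * (qExpansion 1 ⇑F).coeff 3 ∧
      (qExpansion 1 ⇑F).coeff 33 = -2 * (qExpansion 1 ⇑F).coeff 1 + 2 * (qExpansion 1 ⇑F).coeff 3 -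
        (qExpansion 1 ⇑F).coeff 5 + 4 * (qExpansion 1 ⇑F).coeff 11)
    (hinj : ∀ F G : ModularForm (Gamma0 44) 2,
      (qExpansion 1 ⇑F).coeff 0 = (qExpansion 1 ⇑G).coeff 0 → (qExpansion 1 ⇑F).coeff 1 = (qExpansion 1 ⇑G).coeff 1 →
      (qExpansion 1 ⇑F).coeff 2 = (qExpansion 1 ⇑G).coeff 2 → (qExpansion 1 ⇑F).coeff 3 = (qExpansion 1 ⇑G).coeff 3 →
      (qExpansion 1 ⇑F).coeff 4 = (qExpansion 1 ⇑G).coeff 4 → (qExpansion 1 ⇑F).coeff 5 = (qExpansion 1 ⇑G).coeff 5 →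
      (qExpansion 1 ⇑F).coeff 6 = (qExpansion 1 ⇑G).coeff 6 → (qExpansion 1 ⇑F).coeff 8 = (qExpansion 1 ⇑G).coeff 8 →
      (qExpansion 1 ⇑F).coeff 11 = (qExpansion 1 ⇑G).coeff 11 → (F : ℍ → ℂ) = G)
    (hold₁ : ∃ G : CuspForm (Gamma0 44) 2, G ∈ oldSubspace0 44 2 ∧ cuspCoeff G 1 = 1 ∧ cuspCoeff G 2 = -2 ∧
      cuspCoeff G 3 = -1 ∧ cuspCoeff G 4 = 2 ∧ cuspCoeff G 5 = 1 ∧ cuspCoeff G 6 = 2 ∧ cuspCoeff G 8 = 0 ∧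
      cuspCoeff G 11 = 1)
    (hold₂ : ∃ G : CuspForm (Gamma0 44) 2, G ∈ oldSubspace0 44 2 ∧ cuspCoeff G 1 = 1 ∧ cuspCoeff G 2 = 0 ∧
      cuspCoeff G 3 = -1 ∧ cuspCoeff G 4 = 0 ∧ cuspCoeff G 5 = 1 ∧ cuspCoeff G 6 = 0 ∧ cuspCoeff G 8 = 0 ∧
      cuspCoeff G 11 = 1)
    (D : ModularParametrizationData W 44) (Φ : ModularForm (Gamma0 44) 2)
    (e0 : (qExpansion 1 ⇑Φ).coeff 0 = 0) (e1 : (qExpansion 1 ⇑Φ).coeff 1 = 1) (e2 : (qExpansion 1 ⇑Φ).coeff 2 = 0)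
    (e3 : (qExpansion 1 ⇑Φ).coeff 3 = 1) (e4 : (qExpansion 1 ⇑Φ).coeff 4 = 0) (e5 : (qExpansion 1 ⇑Φ).coeff 5 = -3)
    (e6 : (qExpansion 1 ⇑Φ).coeff 6 = 0) (e8 : (qExpansion 1 ⇑Φ).coeff 8 = 0) (e11 : (qExpansion 1 ⇑Φ).coeff 11 = -1) :
    (⇑D.f : ℍ → ℂ) = ⇑Φ := by
  obtain ⟨h2, h3, h4, h5, h6, h8, h11⟩ := coeffs_eq_fortyFourA hrel hinj hold₁ hold₂ D
  have hL1 : W.LFunction 1 = 1 := W.LFunction_apply_one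
  have hcoeF : (⇑(CuspForm.toModularFormₗ D.f) : ℍ → ℂ) = ⇑D.f := funext (CuspForm.toModularFormₗ_apply D.f)
  rw [← hcoeF]
  refine hinj _ _ ?_ ?_ ?_ ?_ ?_ ?_ ?_ ?_ ?_
  · rw [hcoeF, CuspFormClass.qExpansion_coeff_zero D.f one_pos one_mem_strictPeriods_Gamma0, e0]
  · rw [coeff_toModularForm_f D, hL1, e1]; norm_num
  · rw [coeff_toModularForm_f D, h2, e2]; norm_num
  · rw [coeff_toModularForm_f D, h3, e3]; norm_num
  · rw [coeff_toModularForm_f D, h4, e4]; norm_num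
  · rw [coeff_toModularForm_f D, h5, e5]; norm_num
  · rw [coeff_toModularForm_f D, h6, e6]; norm_num
  · rw [coeff_toModularForm_f D, h8, e8]; norm_num
  · rw [coeff_toModularForm_f D, h11, e11]; norm_num

end Summit.BirchSwinnertonDyer.BirchSwinnertonDyer.Theorems.ManinLocalTwoThree.LevelFortyFour

end
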